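import Mathlib
import Summits.Ventures.FusionMHD.Models.CerfonFreidbergIterLikeQHalfShearDefs
import HarnessLib

/-!
# Ventures/FusionMHD — Models/CerfonFreidbergIterLikeQHalfShearPanels10.lean: KERNEL CHECK of the shear-register certificates of panels 18, 19 (of 32)
# at `ψ_N = 1/2` of THE Cerfon–Freidberg ITER-like instance

HONEST FRAMING (LADDER-GRIDFUSION three columns; CF rung; successor step of «q′(ψ_N = 1/2) on the CF rung», F2-SCOPING v1.6 §10(c)).  One `decide +kernel`
(≈ 80 s): for each listed panel the obligation `CFIterLike.QHalfShear.ShearCert.ok` (`Models/CerfonFreidbergIterLikeQHalfShearDefs.lean`) — the Taylor-model run of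
`progQ = CFIterLike.QHalf.progA ++ blockQ` over ★ #117's parameter box is ACCEPTED and the kernel's panel-integral enclosure of the shear kernel `K·p` along the
approximant lies inside the claimed integers (read off a compiled `#eval` of the same functions, slack one unit of `2⁻⁶⁰`; float truth inside every panel).
MODELLED: analytic Cerfon–Freidberg family; nothing about a device or stability.  No `native_decide`.  Typer/prover: gridfusion-model-5 (g8), 2026-08-27.
Citations: Freidberg 2014 §6.3.5 (6.35) [Freidberg2014]; Mahboubi–Melquiond–Sibut-Pinote 2016 §3.2 Lemma 3 [MahboubiMelquiondSibutpinote2016].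
-/

namespace Summit.Ventures.FusionMHD.Models.CFIterLike.QHalfShear

/-- Shear-register certificate data of panels 18, 19. [instance data] -/
def shearCert10 : List ShearCert := [
  { j := 18, cand := [1917128418216080048128, 14290411919854150877184, -43157797666846333206528, -1033853553678832120102912, -1392825373505479054983168, 54315521258294331433811968, 264363417986266034513903616, -2144627821695429093867126784, -21453017156890057846487515136, 49164883062105310240293519360, 1311593098830829143290590265344, 1146670137983276283848070004736, -62403449876624163006576355966976],
    deg := 10, elog2 := 46, plo := 8039556762507585288, phi := 8039557657943069225 },
  { j := 19, cand := [2290464041673517170688, 8682216023434981277696, -129683621061482474635264, -615378744389384068399104, 7665895308515436172148736, 37953485174968793660653568, -444274253466291714675179520, -2175254959422275146601201664, 25459129516580028852635435008, 119460625800232682169303040000, -1449161658565077516368354476032, -6102716844636946702540862390272, 85747959798188262130816678625280],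
    deg := 10, elog2 := 46, plo := 11762821243249922117, phi := 11762822290658144436 }]

/-- **KERNEL CHECK** of the shear register on panels 18, 19. -/
theorem shearCert10_ok : CFIterLike.QHalfShear.shearCert10.all ShearCert.ok = true := by
  decide +kernel

end Summit.Ventures.FusionMHD.Models.CFIterLike.QHalfShear
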